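import Mathlib
import HarnessLib
import Literature.Analysis.FluidPDE.Seregin2020BlowupLimit

/-!
# The blow-up (zoom-in) limit of a suitable weak solution ALONG A PRESCRIBED NULL SEQUENCE OF SCALES
# (Seregin 2014, Prop. 6.20 / Seregin–Shilkin 2018, Thm. 3.5, as printed: "Let `λₖ → 0` be a sequence …")

The tree's `Literature.Analysis.FluidPDE.exists_zoom_blowup_levels` / `exists_zoom_blowup_limit`
(`Seregin2020BlowupLimit.lean`) carry out Seregin's extraction along the DYADIC base scales `λₙ = 2^{-(n+2)}` (a
subsequence of which is selected).  The printed statement is for an ARBITRARY sequence `λₖ → 0`; this file re-runs the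
two proofs VERBATIM with the dyadic base replaced by any base sequence `r : ℕ → ℝ` with `0 < rₙ ≤ 2^{-(n+2)}` (every null
sequence of positive scales has such a subsequence): the levels are still the dyadic multiples
`2ᵐ rₙ` of the base scale, so the level bookkeeping (`2ᵐ rₙ ≤ 1/2` for `m ≤ n`, the ratio `2^{m'-m}` between levels, the
gluing along `Q(2ᵐ/2)`) is unchanged.  Consumer: the prescribed-time zoom of the sequential ε-doors of LADDER-NS N0
(door S26 «StableStrataDoor», SEED-26 input I1, `StableStrataDoorOneSliceDefs.LocalPointZoomAlongTimesM`).

* (private) `level_scale_le_half_along` — `2ᵐ rₙ ≤ 1/2` for `m ≤ n`;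
* `exists_zoom_blowup_levels_along`, `exists_zoom_blowup_limit_along` — the extraction at all levels and the glued limit
  on `ℝ³ × ]-∞, 0[` along a subsequence of the base scales `rₙ`.

WHAT THIS IS NOT: no new mathematics (Seregin 2014 Prop. 6.20 for a general null sequence, proofs = the tree's); not a
claim about Navier–Stokes regularity.

## References

* G. Seregin, *Lecture Notes on Regularity Theory for the Navier–Stokes Equations*, World Scientific 2014, §6.6,
  Prop. 6.20. [Seregin2014]
* G. Seregin, T. Shilkin, Russian Math. Surveys 73 (2018), Thm. 3.5. [SereginShilkin2018]
-/

noncomputable section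

open MeasureTheory Set Function Filter Topology TopologicalSpace Metric
open scoped NNReal ENNReal

namespace Literature.Analysis.FluidPDE

/-! ### Base scales below the dyadic ones -/

/-- Level bookkeeping: `2ᵐ rₙ ≤ 1/2` whenever `rₙ ≤ 2^{-(n+2)}` and `m ≤ n`. [folklore] -/
private theorem level_scale_le_half_along {r : ℕ → ℝ} (hrle : ∀ n, r n ≤ (1 / 2 : ℝ) ^ (n + 2))
    {m n : ℕ} (hmn : m ≤ n) : (2 : ℝ) ^ m * r n ≤ 1 / 2 := by
  have h1 : (2 : ℝ) ^ m * r n ≤ (2 : ℝ) ^ m * (1 / 2 : ℝ) ^ (n + 2) :=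
    mul_le_mul_of_nonneg_left (hrle n) (by positivity)
  exact h1.trans (level_scale_le_half hmn)

section Levels

variable {v : ℝ → EuclideanSpace ℝ (Fin 3) → EuclideanSpace ℝ (Fin 3)}
  {p : ℝ → EuclideanSpace ℝ (Fin 3) → ℝ}

/-- **The blow-up extraction at all levels ALONG PRESCRIBED BASE SCALES** `rₙ`, `0 < rₙ ≤ 2^{-(n+2)}`
(Seregin 2014, Prop. 6.20; Seregin–Shilkin 2018, Thm. 3.5; dyadic version: `exists_zoom_blowup_levels`). Let
`(v, p)` and `z₀` be such that every rescaled pair `(c v ∘ Φ_c, c² p ∘ Φ_c)`,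
`Φ_c(s, y) = (t₀ + c² s, x₀ + c y)`, `0 < c ≤ 1/2`, is a suitable weak solution in the unit ball
(`IsSuitableWeakSolutionInBall 1 0`) and `C(v; z₀, r) ≤ M`, `D(p; z₀, r) ≤ D` for `0 < r ≤ 1/2`.
With the base scales `rₙ` there are a strictly increasing `δ : ℕ → ℕ`, `δ(k) ≥ k`, and
for every level `m` a pair `(u_m, q_m)`, suitable on every `Q(R)`, `0 < R < 1`, with
`u_m ∈ L³(Q(R))`, such that along `j ↦ δ(j + m)` the rescaled pairs at the scales `2ᵐ r_{δ(j+m)}`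
converge to `(u_m, q_m)`: velocities strongly in `L³(Q(R))`, pressures weakly in `L^{3/2}(Q(R))`.
Proof: verbatim the proof of `exists_zoom_blowup_levels` (compactness `SuitableCompactness_holds` at
each level, diagonal lemma `exists_diagonal_subsequence`).
[cite: Seregin2014, §6.6 Prop. 6.20] [cite: Seregin2020, proof of Thm. 2.1 (the rescaling `uᵏ = λₖ v(λₖ y, λₖ² s)`, properties (𝒜))] -/
theorem exists_zoom_blowup_levels_along
    {z₀ : ℝ × EuclideanSpace ℝ (Fin 3)}
    (hsuit : ∀ c ∈ Ioc (0 : ℝ) (1 / 2), IsSuitableWeakSolutionInBall 1 0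
      (c • stPull (c ^ 2) c z₀.1 z₀.2 v) (c ^ 2 • stPull (c ^ 2) c z₀.1 z₀.2 p))
    {M D : ℝ≥0} (hM : ∀ r ∈ Ioc (0 : ℝ) (1 / 2), cknC r z₀ v ≤ M)
    (hD : ∀ r ∈ Ioc (0 : ℝ) (1 / 2), cknD r z₀ p ≤ D)
    {r : ℕ → ℝ} (hr : ∀ n, 0 < r n) (hrle : ∀ n, r n ≤ (1 / 2 : ℝ) ^ (n + 2)) :
    ∃ δ : ℕ → ℕ, StrictMono δ ∧ (∀ k, k ≤ δ k) ∧ ∀ m : ℕ,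
      ∃ (u : ℝ → EuclideanSpace ℝ (Fin 3) → EuclideanSpace ℝ (Fin 3))
        (q : ℝ → EuclideanSpace ℝ (Fin 3) → ℝ), ∀ R ∈ Ioo (0 : ℝ) 1,
        IsSuitableWeakSolutionInBall R 0 u q ∧
        MemLp (uncurry u) 3
          (volume.restrict (parabolicCylinder R (0 : ℝ × EuclideanSpace ℝ (Fin 3)))) ∧
        Tendsto (fun j => eLpNorm
            (uncurry (((2 : ℝ) ^ m * r (δ (j + m))) •
                stPull (((2 : ℝ) ^ m * r (δ (j + m))) ^ 2)
                  ((2 : ℝ) ^ m * r (δ (j + m))) z₀.1 z₀.2 v) - uncurry u) 3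
            (volume.restrict (parabolicCylinder R (0 : ℝ × EuclideanSpace ℝ (Fin 3)))))
          atTop (𝓝 0) ∧
        ∀ g : ℝ × EuclideanSpace ℝ (Fin 3) → ℝ,
          MemLp g 3 (volume.restrict (parabolicCylinder R (0 : ℝ × EuclideanSpace ℝ (Fin 3)))) →
          Tendsto (fun j => ∫ w in parabolicCylinder R (0 : ℝ × EuclideanSpace ℝ (Fin 3)),
              (((2 : ℝ) ^ m * r (δ (j + m))) ^ 2 •
                stPull (((2 : ℝ) ^ m * r (δ (j + m))) ^ 2)
                  ((2 : ℝ) ^ m * r (δ (j + m))) z₀.1 z₀.2 p) w.1 w.2 * g w)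
            atTop (𝓝 (∫ w in parabolicCylinder R (0 : ℝ × EuclideanSpace ℝ (Fin 3)),
              q w.1 w.2 * g w)) := by
  -- ## abbreviations: scales, zooms, the cylinders' measures, goodness
  set sc : ℕ → ℕ → ℝ := fun m n => (2 : ℝ) ^ m * r n with hsc
  set Uz : ℝ → ℝ → EuclideanSpace ℝ (Fin 3) → EuclideanSpace ℝ (Fin 3) :=
    fun r => r • stPull (r ^ 2) r z₀.1 z₀.2 v with hUz
  set Pz : ℝ → ℝ → EuclideanSpace ℝ (Fin 3) → ℝ :=
    fun r => r ^ 2 • stPull (r ^ 2) r z₀.1 z₀.2 p with hPz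
  set μ : ℝ → Measure (ℝ × EuclideanSpace ℝ (Fin 3)) :=
    fun R => volume.restrict (parabolicCylinder R (0 : ℝ × EuclideanSpace ℝ (Fin 3))) with hμ
  set Good : ℕ → (ℕ → ℕ) →
      ((ℝ → EuclideanSpace ℝ (Fin 3) → EuclideanSpace ℝ (Fin 3)) ×
        (ℝ → EuclideanSpace ℝ (Fin 3) → ℝ)) → Prop :=
    fun m ρ d => ∀ R ∈ Ioo (0 : ℝ) 1,
      IsSuitableWeakSolutionInBall R 0 d.1 d.2 ∧ MemLp (uncurry d.1) 3 (μ R) ∧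
      Tendsto (fun j => eLpNorm (uncurry (Uz (sc m (ρ j))) - uncurry d.1) 3 (μ R)) atTop (𝓝 0) ∧
      ∀ g : ℝ × EuclideanSpace ℝ (Fin 3) → ℝ, MemLp g 3 (μ R) →
        Tendsto (fun j => ∫ w in parabolicCylinder R (0 : ℝ × EuclideanSpace ℝ (Fin 3)),
            (Pz (sc m (ρ j))) w.1 w.2 * g w) atTop
          (𝓝 (∫ w in parabolicCylinder R (0 : ℝ × EuclideanSpace ℝ (Fin 3)), d.2 w.1 w.2 * g w))
    with hGood
  -- ## goodness is stable under subsequences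
  have hsub : ∀ (m : ℕ) (ρ : ℕ → ℕ) d (φ : ℕ → ℕ), Good m ρ d → StrictMono φ →
      Good m (ρ ∘ φ) d := by
    intro m ρ d φ hg hφ R hR
    obtain ⟨h1, h2, h3, h4⟩ := hg R hR
    exact ⟨h1, h2, h3.comp hφ.tendsto_atTop, fun g hg' => (h4 g hg').comp hφ.tendsto_atTop⟩
  -- ## extraction at one level (the compactness theorem)
  have hstep : ∀ (m : ℕ) (τ : ℕ → ℕ), StrictMono τ → (∀ k, m ≤ τ k) →
      ∃ σ : ℕ → ℕ, StrictMono σ ∧ ∃ d, Good m (τ ∘ σ) d := by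
    intro m τ hτ hval
    have hscale : ∀ k, sc m (τ k) ∈ Ioc (0 : ℝ) (1 / 2) := fun k =>
      ⟨mul_pos (by positivity) (hr _), level_scale_le_half_along hrle (hval k)⟩
    have hsuit : ∀ k, IsSuitableWeakSolutionInBall 1 0 (Uz (sc m (τ k))) (Pz (sc m (τ k))) :=
      fun k => hsuit _ (hscale k)
    have hbound : (⨆ k, eLpNorm (uncurry (Uz (sc m (τ k)))) 3 (μ 1) +
        eLpNorm (uncurry (Pz (sc m (τ k)))) (3 / 2) (μ 1)) < ∞ := by
      refine lt_of_le_of_lt (iSup_le fun k => eLpNorm_zoom_add_le_of hM hD (hscale k)) ?_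
      exact ENNReal.add_lt_top.2
        ⟨ENNReal.rpow_lt_top_of_nonneg (by norm_num) ENNReal.coe_ne_top,
          ENNReal.rpow_lt_top_of_nonneg (by norm_num) ENNReal.coe_ne_top⟩
    obtain ⟨u, q, σ, hσ, hconv⟩ :=
      SuitableCompactness_holds (fun k => Uz (sc m (τ k))) (fun k => Pz (sc m (τ k))) hsuit hbound
    exact ⟨σ, hσ, (u, q), fun R hR => hconv R hR⟩
  -- ## the diagonal
  obtain ⟨δ, hδ, hδge, hgood⟩ := exists_diagonal_subsequence Good hsub hstep
  refine ⟨δ, hδ, hδge, fun m => ?_⟩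
  obtain ⟨⟨u, q⟩, hd⟩ := hgood m
  exact ⟨u, q, fun R hR => hd R hR⟩

end Levels

section Limit

variable {v : ℝ → EuclideanSpace ℝ (Fin 3) → EuclideanSpace ℝ (Fin 3)}
  {p : ℝ → EuclideanSpace ℝ (Fin 3) → ℝ}

/-- **The blow-up limit on `ℝ³ × ]-∞, 0[` ALONG PRESCRIBED BASE SCALES** `rₙ`, `0 < rₙ ≤ 2^{-(n+2)}`
(Seregin 2014, Prop. 6.20, first part, as printed for an arbitrary null sequence; Seregin–Shilkin 2018, Thm. 3.5;
dyadic version: `exists_zoom_blowup_limit`). Under the hypotheses of `exists_zoom_blowup_levels_along` there are a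
strictly increasing `δ` with `δ(k) ≥ k` and a pair `(w, π)` on `ℝ × ℝ³` such that for every `a > 0`: `(w, π)` is
a suitable weak solution on `Q(a)` (`IsSuitableWeakSolutionInBall a 0 w π`), `w ∈ L³(Q(a))`, and along the scales
`μ_j = r_{δ(j)} → 0` the rescaled velocities `u^{μ_j}(s, y) = μ_j v(t₀ + μ_j² s, x₀ + μ_j y)` converge to `w` in
`L³(Q(a))` while the rescaled pressures `μ_j² p ∘ Φ_{μ_j}` converge to `π` weakly in `L^{3/2}(Q(a))`.  Proof:
verbatim the proof of `exists_zoom_blowup_limit` (level limits zoomed back, uniqueness of strong/weak limits,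
gluing along `Q(2ᵐ/2)`).
[cite: Seregin2014, §6.6 Prop. 6.20] [cite: Seregin2020, proof of Thm. 2.1, properties (𝒜) (i)] -/
theorem exists_zoom_blowup_limit_along
    {z₀ : ℝ × EuclideanSpace ℝ (Fin 3)}
    (hv : AEStronglyMeasurable (uncurry v) (volume.restrict (parabolicCylinder (1 / 2) z₀)))
    (hsuit : ∀ c ∈ Ioc (0 : ℝ) (1 / 2), IsSuitableWeakSolutionInBall 1 0
      (c • stPull (c ^ 2) c z₀.1 z₀.2 v) (c ^ 2 • stPull (c ^ 2) c z₀.1 z₀.2 p))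
    {M D : ℝ≥0} (hM : ∀ r ∈ Ioc (0 : ℝ) (1 / 2), cknC r z₀ v ≤ M)
    (hD : ∀ r ∈ Ioc (0 : ℝ) (1 / 2), cknD r z₀ p ≤ D)
    {r : ℕ → ℝ} (hr : ∀ n, 0 < r n) (hrle : ∀ n, r n ≤ (1 / 2 : ℝ) ^ (n + 2)) :
    ∃ (δ : ℕ → ℕ) (w : ℝ → EuclideanSpace ℝ (Fin 3) → EuclideanSpace ℝ (Fin 3))
      (π : ℝ → EuclideanSpace ℝ (Fin 3) → ℝ), StrictMono δ ∧ (∀ k, k ≤ δ k) ∧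
      ∀ a : ℝ, 0 < a →
        IsSuitableWeakSolutionInBall a 0 w π ∧
        MemLp (uncurry w) 3
          (volume.restrict (parabolicCylinder a (0 : ℝ × EuclideanSpace ℝ (Fin 3)))) ∧
        Tendsto (fun j => eLpNorm
            (uncurry ((r (δ j)) •
                stPull ((r (δ j)) ^ 2) (r (δ j)) z₀.1 z₀.2 v) -
              uncurry w) 3
            (volume.restrict (parabolicCylinder a (0 : ℝ × EuclideanSpace ℝ (Fin 3)))))
          atTop (𝓝 0) ∧
        ∀ g : ℝ × EuclideanSpace ℝ (Fin 3) → ℝ,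
          MemLp g 3 (volume.restrict (parabolicCylinder a (0 : ℝ × EuclideanSpace ℝ (Fin 3)))) →
          Tendsto (fun j => ∫ w' in parabolicCylinder a (0 : ℝ × EuclideanSpace ℝ (Fin 3)),
              (((r (δ j)) ^ 2) •
                stPull ((r (δ j)) ^ 2) (r (δ j)) z₀.1 z₀.2 p)
                  w'.1 w'.2 * g w')
            atTop (𝓝 (∫ w' in parabolicCylinder a (0 : ℝ × EuclideanSpace ℝ (Fin 3)),
              π w'.1 w'.2 * g w')) := by
  classical
  obtain ⟨δ, hδ, hδge, hlev⟩ := exists_zoom_blowup_levels_along hsuit hM hD hr hrle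
  choose u q hgood using hlev
  -- ## abbreviations
  set lam : ℕ → ℝ := fun n => r n with hlam
  set Uz : ℝ → ℝ → EuclideanSpace ℝ (Fin 3) → EuclideanSpace ℝ (Fin 3) :=
    fun r => r • stPull (r ^ 2) r z₀.1 z₀.2 v with hUz
  set Pz : ℝ → ℝ → EuclideanSpace ℝ (Fin 3) → ℝ :=
    fun r => r ^ 2 • stPull (r ^ 2) r z₀.1 z₀.2 p with hPz
  set cc : ℕ → ℝ := fun m => (2 : ℝ) ^ m with hcc
  have hcc_pos : ∀ m, 0 < cc m := fun m => by positivity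
  have hlam_pos : ∀ n, 0 < lam n := fun n => hr n
  set wl : ℕ → ℝ → EuclideanSpace ℝ (Fin 3) → EuclideanSpace ℝ (Fin 3) :=
    fun m => (cc m)⁻¹ • stPull ((cc m)⁻¹ ^ 2) (cc m)⁻¹ (0 : ℝ) (0 : EuclideanSpace ℝ (Fin 3)) (u m)
    with hwl
  set πl : ℕ → ℝ → EuclideanSpace ℝ (Fin 3) → ℝ :=
    fun m => (cc m)⁻¹ ^ 2 • stPull ((cc m)⁻¹ ^ 2) (cc m)⁻¹ (0 : ℝ) (0 : EuclideanSpace ℝ (Fin 3)) (q m)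
    with hπl
  -- ## the zoom relations
  have hUz_level : ∀ m n, Uz (cc m * lam n) =
      cc m • stPull (cc m ^ 2) (cc m) (0 : ℝ) (0 : EuclideanSpace ℝ (Fin 3)) (Uz (lam n)) := by
    intro m n
    show (cc m * lam n) • stPull ((cc m * lam n) ^ 2) (cc m * lam n) z₀.1 z₀.2 v = _
    rw [zoom_zoom]
  have hPz_level : ∀ m n, Pz (cc m * lam n) =
      cc m ^ 2 • stPull (cc m ^ 2) (cc m) (0 : ℝ) (0 : EuclideanSpace ℝ (Fin 3)) (Pz (lam n)) := by
    intro m n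
    show (cc m * lam n) ^ 2 • stPull ((cc m * lam n) ^ 2) (cc m * lam n) z₀.1 z₀.2 p = _
    rw [zoom_zoom, mul_pow]
  have hu_wl : ∀ m, u m = cc m • stPull (cc m ^ 2) (cc m) (0 : ℝ) (0 : EuclideanSpace ℝ (Fin 3)) (wl m) :=
    fun m => (zoom_zoom_origin_inv (hcc_pos m).ne' _ _ (mul_inv_cancel₀ (hcc_pos m).ne') (u m)).symm
  have hq_πl : ∀ m, q m =
      cc m ^ 2 • stPull (cc m ^ 2) (cc m) (0 : ℝ) (0 : EuclideanSpace ℝ (Fin 3)) (πl m) :=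
    fun m => (zoom_zoom_origin_inv (hcc_pos m).ne' _ _
      (by rw [← mul_pow, mul_inv_cancel₀ (hcc_pos m).ne', one_pow]) (q m)).symm
  -- the cylinders of level `m`
  have hcyl : ∀ m (R : ℝ), parabolicCylinder R (0 : ℝ × EuclideanSpace ℝ (Fin 3)) =
      parabolicCylinder ((cc m * R) / cc m) (0 : ℝ × EuclideanSpace ℝ (Fin 3)) := by
    intro m R; rw [mul_div_cancel_left₀ R (hcc_pos m).ne']
  have hcyl' : ∀ m (R : ℝ), parabolicCylinder (R / (cc m)⁻¹) (0 : ℝ × EuclideanSpace ℝ (Fin 3)) =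
      parabolicCylinder (cc m * R) (0 : ℝ × EuclideanSpace ℝ (Fin 3)) := by
    intro m R; rw [div_inv_eq_mul, mul_comm]
  -- ## (A) strong convergence at level `m`, in the base scale, on `Q(2ᵐ R)`
  have hbase : ∀ m, ∀ R ∈ Ioo (0 : ℝ) 1,
      Tendsto (fun j => eLpNorm (uncurry (Uz (lam (δ (j + m)))) - uncurry (wl m)) 3
        (volume.restrict (parabolicCylinder (cc m * R) (0 : ℝ × EuclideanSpace ℝ (Fin 3)))))
        atTop (𝓝 0) := by
    intro m R hR
    obtain ⟨-, -, h3, -⟩ := hgood m R hR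
    have h3' : Tendsto (fun j => eLpNorm (uncurry (Uz (cc m * lam (δ (j + m)))) - uncurry (u m)) 3
        (volume.restrict (parabolicCylinder R (0 : ℝ × EuclideanSpace ℝ (Fin 3))))) atTop (𝓝 0) :=
      h3
    set K : ℝ≥0∞ := ‖cc m‖ₑ * (ENNReal.ofReal (cc m ^ 2 * cc m ^ 3)⁻¹) ^ (1 / (3 : ℝ≥0∞).toReal)
      with hK
    have key : ∀ j, eLpNorm (uncurry (Uz (cc m * lam (δ (j + m)))) - uncurry (u m)) 3
        (volume.restrict (parabolicCylinder R (0 : ℝ × EuclideanSpace ℝ (Fin 3)))) =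
        K * eLpNorm (uncurry (Uz (lam (δ (j + m)))) - uncurry (wl m)) 3
          (volume.restrict (parabolicCylinder (cc m * R) (0 : ℝ × EuclideanSpace ℝ (Fin 3)))) := by
      intro j
      rw [hUz_level, hu_wl m]
      have e1 : uncurry (cc m • stPull (cc m ^ 2) (cc m) (0 : ℝ) (0 : EuclideanSpace ℝ (Fin 3))
            (Uz (lam (δ (j + m))))) -
          uncurry (cc m • stPull (cc m ^ 2) (cc m) (0 : ℝ) (0 : EuclideanSpace ℝ (Fin 3)) (wl m)) =
          uncurry (cc m • stPull (cc m ^ 2) (cc m) (0 : ℝ) (0 : EuclideanSpace ℝ (Fin 3))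
            (Uz (lam (δ (j + m))) - wl m)) := by
        funext z
        show _ - _ = cc m • (Uz (lam (δ (j + m))) - wl m) _ _
        rw [Pi.sub_apply, Pi.sub_apply, smul_sub]
        rfl
      rw [e1, hcyl m R, eLpNorm_uncurry_zoom (hcc_pos m) (cc m) _ (cc m * R) (by norm_num)
        (by norm_num)]
      rfl
    have hK0 : K ≠ 0 := by
      refine mul_ne_zero ?_ ?_
      · rw [Real.enorm_eq_ofReal (hcc_pos m).le]; exact (ENNReal.ofReal_pos.2 (hcc_pos m)).ne'
      · exact (ENNReal.rpow_pos (ENNReal.ofReal_pos.2 (by positivity)) ENNReal.ofReal_ne_top).ne'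
    have hKtop : K ≠ ⊤ :=
      ENNReal.mul_ne_top enorm_ne_top (ENNReal.rpow_ne_top_of_nonneg (by positivity) ENNReal.ofReal_ne_top)
    simp only [key] at h3'
    have h4 := ENNReal.Tendsto.const_mul h3' (Or.inr (ENNReal.inv_ne_top.2 hK0)) (a := K⁻¹)
    simp only [mul_zero, ← mul_assoc, ENNReal.inv_mul_cancel hK0 hKtop, one_mul] at h4
    exact h4
  -- the same along the unshifted sequence
  have hbase' : ∀ m, ∀ R ∈ Ioo (0 : ℝ) 1,
      Tendsto (fun j => eLpNorm (uncurry (Uz (lam (δ j))) - uncurry (wl m)) 3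
        (volume.restrict (parabolicCylinder (cc m * R) (0 : ℝ × EuclideanSpace ℝ (Fin 3)))))
        atTop (𝓝 0) := fun m R hR =>
    (tendsto_add_atTop_iff_nat (f := fun j => eLpNorm (uncurry (Uz (lam (δ j))) - uncurry (wl m)) 3
      (volume.restrict (parabolicCylinder (cc m * R) (0 : ℝ × EuclideanSpace ℝ (Fin 3))))) m).1
      (hbase m R hR)
  -- ## (B) weak convergence of the pressures at level `m`, in the base scale, on `Q(2ᵐ R)`
  have hweak : ∀ m, ∀ R ∈ Ioo (0 : ℝ) 1, ∀ g : ℝ × EuclideanSpace ℝ (Fin 3) → ℝ,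
      MemLp g 3 (volume.restrict (parabolicCylinder (cc m * R) (0 : ℝ × EuclideanSpace ℝ (Fin 3)))) →
      Tendsto (fun j => ∫ w in parabolicCylinder (cc m * R) (0 : ℝ × EuclideanSpace ℝ (Fin 3)),
          (Pz (lam (δ (j + m)))) w.1 w.2 * g w) atTop
        (𝓝 (∫ w in parabolicCylinder (cc m * R) (0 : ℝ × EuclideanSpace ℝ (Fin 3)),
          (πl m) w.1 w.2 * g w)) := by
    intro m R hR g hg
    obtain ⟨-, -, -, h4⟩ := hgood m R hR
    have hg' : MemLp (g ∘ stAffine (cc m ^ 2) (cc m) (0 : ℝ) (0 : EuclideanSpace ℝ (Fin 3))) 3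
        (volume.restrict (parabolicCylinder R (0 : ℝ × EuclideanSpace ℝ (Fin 3)))) := by
      rw [hcyl m R]
      exact memLp_comp_zoom (hcc_pos m) (by norm_num) (by norm_num) hg
    have h5 : Tendsto (fun j => ∫ w in parabolicCylinder R (0 : ℝ × EuclideanSpace ℝ (Fin 3)),
        (Pz (cc m * lam (δ (j + m)))) w.1 w.2 *
          (g ∘ stAffine (cc m ^ 2) (cc m) (0 : ℝ) (0 : EuclideanSpace ℝ (Fin 3))) w) atTop
        (𝓝 (∫ w in parabolicCylinder R (0 : ℝ × EuclideanSpace ℝ (Fin 3)),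
          (q m) w.1 w.2 * (g ∘ stAffine (cc m ^ 2) (cc m) (0 : ℝ) (0 : EuclideanSpace ℝ (Fin 3))) w)) :=
      h4 _ hg'
    set K : ℝ := cc m ^ 2 * (cc m ^ 2 * cc m ^ 3)⁻¹ with hK
    have hK0 : K ≠ 0 := by positivity
    have key : ∀ ρ : ℝ → EuclideanSpace ℝ (Fin 3) → ℝ,
        ∫ w in parabolicCylinder R (0 : ℝ × EuclideanSpace ℝ (Fin 3)),
          (cc m ^ 2 • stPull (cc m ^ 2) (cc m) (0 : ℝ) (0 : EuclideanSpace ℝ (Fin 3)) ρ) w.1 w.2 *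
            (g ∘ stAffine (cc m ^ 2) (cc m) (0 : ℝ) (0 : EuclideanSpace ℝ (Fin 3))) w =
          K * ∫ w in parabolicCylinder (cc m * R) (0 : ℝ × EuclideanSpace ℝ (Fin 3)),
            ρ w.1 w.2 * g w := by
      intro ρ
      rw [hcyl m R]
      exact setIntegral_zoom_pressure_mul (hcc_pos m) _ ρ g (cc m * R)
    simp only [hPz_level, hq_πl m, key] at h5
    have h6 := h5.const_mul K⁻¹
    simp only [← mul_assoc, inv_mul_cancel₀ hK0, one_mul] at h6
    exact h6
  have hweak' : ∀ m, ∀ R ∈ Ioo (0 : ℝ) 1, ∀ g : ℝ × EuclideanSpace ℝ (Fin 3) → ℝ,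
      MemLp g 3 (volume.restrict (parabolicCylinder (cc m * R) (0 : ℝ × EuclideanSpace ℝ (Fin 3)))) →
      Tendsto (fun j => ∫ w in parabolicCylinder (cc m * R) (0 : ℝ × EuclideanSpace ℝ (Fin 3)),
          (Pz (lam (δ j))) w.1 w.2 * g w) atTop
        (𝓝 (∫ w in parabolicCylinder (cc m * R) (0 : ℝ × EuclideanSpace ℝ (Fin 3)),
          (πl m) w.1 w.2 * g w)) := fun m R hR g hg =>
    (tendsto_add_atTop_iff_nat (f := fun j => ∫ w in parabolicCylinder (cc m * R)
      (0 : ℝ × EuclideanSpace ℝ (Fin 3)), (Pz (lam (δ j))) w.1 w.2 * g w) m).1 (hweak m R hR g hg)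
  -- ## measurability and integrability
  have hUz_meas : ∀ a : ℝ, 0 < a → ∃ j₀ : ℕ, ∀ j, j₀ ≤ j →
      AEStronglyMeasurable (uncurry (Uz (lam (δ j))))
        (volume.restrict (parabolicCylinder a (0 : ℝ × EuclideanSpace ℝ (Fin 3)))) := by
    intro a ha
    have ht : Tendsto (fun n : ℕ => a * (1 / 2 : ℝ) ^ (n + 2)) atTop (𝓝 (a * 0)) :=
      ((tendsto_pow_atTop_nhds_zero_of_lt_one (by norm_num) (by norm_num)).comp
        (tendsto_add_atTop_nat 2)).const_mul a
    rw [mul_zero] at ht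
    obtain ⟨j₀, hj₀⟩ := (ht.eventually (gt_mem_nhds (by norm_num : (0 : ℝ) < 1 / 2))).exists_forall_of_atTop
    refine ⟨j₀, fun j hj => ?_⟩
    refine aestronglyMeasurable_uncurry_zoom_of hv (hlam_pos _) ha ?_
    have h1 : (1 / 2 : ℝ) ^ (δ j + 2) ≤ (1 / 2) ^ (j₀ + 2) :=
      pow_le_pow_of_le_one (by norm_num) (by norm_num) (by have := hδge j; omega)
    have h2 := hj₀ j₀ le_rfl
    have h3 : lam (δ j) ≤ (1 / 2 : ℝ) ^ (δ j + 2) := hrle (δ j)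
    show a * lam (δ j) ≤ 1 / 2
    nlinarith [pow_nonneg (by norm_num : (0 : ℝ) ≤ 1 / 2) (δ j + 2), (hlam_pos (δ j)).le]
  have hwl_memLp : ∀ m, ∀ R ∈ Ioo (0 : ℝ) 1, MemLp (uncurry (wl m)) 3
      (volume.restrict (parabolicCylinder (cc m * R) (0 : ℝ × EuclideanSpace ℝ (Fin 3)))) := by
    intro m R hR
    obtain ⟨-, h2, -, -⟩ := hgood m R hR
    have h1 := (memLp_comp_zoom (inv_pos.2 (hcc_pos m)) (by norm_num) (by norm_num) h2).const_smul
      (cc m)⁻¹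
    rw [hcyl'] at h1
    exact h1
  have hπl_memLp : ∀ m, ∀ R ∈ Ioo (0 : ℝ) 1, MemLp (uncurry (πl m)) (3 / 2)
      (volume.restrict (parabolicCylinder (cc m * R) (0 : ℝ × EuclideanSpace ℝ (Fin 3)))) := by
    intro m R hR
    obtain ⟨h1, -, -, -⟩ := hgood m R hR
    have h2 := (memLp_comp_zoom (inv_pos.2 (hcc_pos m)) (by norm_num)
      (ENNReal.div_ne_top (by norm_num) (by norm_num)) h1.2.2.2).const_smul ((cc m)⁻¹ ^ 2)
    rw [hcyl'] at h2
    exact h2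
  -- ## (C) consecutive levels agree a.e.
  have hstep_cyl : ∀ m (R : ℝ), cc (m + 1) * (R / 2) = cc m * R := by
    intro m R; show (2 : ℝ) ^ (m + 1) * (R / 2) = 2 ^ m * R; rw [pow_succ]; ring
  have hcons_w : ∀ m, ∀ R ∈ Ioo (0 : ℝ) 1,
      ∀ᵐ z ∂(volume.restrict (parabolicCylinder (cc m * R) (0 : ℝ × EuclideanSpace ℝ (Fin 3)))),
        uncurry (wl m) z = uncurry (wl (m + 1)) z := by
    intro m R hR
    have hR2 : R / 2 ∈ Ioo (0 : ℝ) 1 := ⟨by linarith [hR.1], by linarith [hR.2]⟩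
    have h1 := hbase' m R hR
    have h2 := hbase' (m + 1) (R / 2) hR2
    have hm2 := hwl_memLp (m + 1) (R / 2) hR2
    rw [hstep_cyl] at h2 hm2
    obtain ⟨j₀, hj₀⟩ := hUz_meas (cc m * R) (by have := hcc_pos m; have := hR.1; positivity)
    have h1' := (tendsto_add_atTop_iff_nat (f := fun j => eLpNorm (uncurry (Uz (lam (δ j))) -
      uncurry (wl m)) 3 (volume.restrict (parabolicCylinder (cc m * R)
        (0 : ℝ × EuclideanSpace ℝ (Fin 3))))) j₀).2 h1
    have h2' := (tendsto_add_atTop_iff_nat (f := fun j => eLpNorm (uncurry (Uz (lam (δ j))) -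
      uncurry (wl (m + 1))) 3 (volume.restrict (parabolicCylinder (cc m * R)
        (0 : ℝ × EuclideanSpace ℝ (Fin 3))))) j₀).2 h2
    exact ae_eq_of_tendsto_eLpNorm_sub (by norm_num) (fun j => hj₀ (j + j₀) (Nat.le_add_left _ _))
      (hwl_memLp m R hR).1 hm2.1 h1' h2'
  have hcons_π : ∀ m, ∀ R ∈ Ioo (0 : ℝ) 1,
      ∀ᵐ z ∂(volume.restrict (parabolicCylinder (cc m * R) (0 : ℝ × EuclideanSpace ℝ (Fin 3)))),
        uncurry (πl m) z = uncurry (πl (m + 1)) z := by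
    intro m R hR
    have hR2 : R / 2 ∈ Ioo (0 : ℝ) 1 := ⟨by linarith [hR.1], by linarith [hR.2]⟩
    have hm2 := hπl_memLp (m + 1) (R / 2) hR2
    rw [hstep_cyl] at hm2
    refine ae_eq_of_forall_setIntegral_mul_eq (hπl_memLp m R hR) hm2 fun g hg => ?_
    have h1 := hweak m R hR g hg
    have h2 := hweak (m + 1) (R / 2) hR2 g (by rw [hstep_cyl]; exact hg)
    rw [hstep_cyl] at h2
    -- align the shifts: `j + 1 + m = j + (m + 1)`
    have h1' := (tendsto_add_atTop_iff_nat (f := fun j => ∫ w in parabolicCylinder (cc m * R)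
      (0 : ℝ × EuclideanSpace ℝ (Fin 3)), (Pz (lam (δ (j + m)))) w.1 w.2 * g w) 1).2 h1
    have e : (fun j => (fun j => ∫ w in parabolicCylinder (cc m * R)
        (0 : ℝ × EuclideanSpace ℝ (Fin 3)), (Pz (lam (δ (j + m)))) w.1 w.2 * g w) (j + 1)) =
        fun j => ∫ w in parabolicCylinder (cc m * R) (0 : ℝ × EuclideanSpace ℝ (Fin 3)),
          (Pz (lam (δ (j + (m + 1))))) w.1 w.2 * g w := by
      funext j
      show ∫ w in parabolicCylinder (cc m * R) (0 : ℝ × EuclideanSpace ℝ (Fin 3)),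
          (Pz (lam (δ (j + 1 + m)))) w.1 w.2 * g w = _
      rw [show j + 1 + m = j + (m + 1) by ring]
    rw [e] at h1'
    exact tendsto_nhds_unique h1' h2
  -- iterated consistency
  have hcons_w' : ∀ n m, n ≤ m → ∀ R ∈ Ioo (0 : ℝ) 1,
      ∀ᵐ z ∂(volume.restrict (parabolicCylinder (cc n * R) (0 : ℝ × EuclideanSpace ℝ (Fin 3)))),
        uncurry (wl n) z = uncurry (wl m) z := by
    intro n m hnm R hR
    induction m, hnm using Nat.le_induction with
    | base => exact ae_of_all _ fun z => rfl
    | succ m hnm ih =>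
        have hsub : parabolicCylinder (cc n * R) (0 : ℝ × EuclideanSpace ℝ (Fin 3)) ⊆
            parabolicCylinder (cc m * R) (0 : ℝ × EuclideanSpace ℝ (Fin 3)) :=
          parabolicCylinder_mono (by have := hcc_pos n; have := hR.1; positivity)
            (mul_le_mul_of_nonneg_right (pow_le_pow_right₀ (by norm_num) hnm) hR.1.le) _
        filter_upwards [ih, ae_restrict_of_ae_restrict_of_subset hsub (hcons_w m R hR)] with z h1 h2
        rw [h1, h2]
  have hcons_π' : ∀ n m, n ≤ m → ∀ R ∈ Ioo (0 : ℝ) 1,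
      ∀ᵐ z ∂(volume.restrict (parabolicCylinder (cc n * R) (0 : ℝ × EuclideanSpace ℝ (Fin 3)))),
        uncurry (πl n) z = uncurry (πl m) z := by
    intro n m hnm R hR
    induction m, hnm using Nat.le_induction with
    | base => exact ae_of_all _ fun z => rfl
    | succ m hnm ih =>
        have hsub : parabolicCylinder (cc n * R) (0 : ℝ × EuclideanSpace ℝ (Fin 3)) ⊆
            parabolicCylinder (cc m * R) (0 : ℝ × EuclideanSpace ℝ (Fin 3)) :=
          parabolicCylinder_mono (by have := hcc_pos n; have := hR.1; positivity)
            (mul_le_mul_of_nonneg_right (pow_le_pow_right₀ (by norm_num) hnm) hR.1.le) _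
        filter_upwards [ih, ae_restrict_of_ae_restrict_of_subset hsub (hcons_π m R hR)] with z h1 h2
        rw [h1, h2]
  -- ## (D) gluing along the exhaustion `Q(2ᵐ / 2)`
  set w : ℝ → EuclideanSpace ℝ (Fin 3) → EuclideanSpace ℝ (Fin 3) := fun s y =>
    if hz : ∃ m : ℕ, ((s, y) : ℝ × EuclideanSpace ℝ (Fin 3)) ∈
        parabolicCylinder (cc m / 2) (0 : ℝ × EuclideanSpace ℝ (Fin 3))
    then wl (Nat.find hz) s y else 0 with hw
  set π : ℝ → EuclideanSpace ℝ (Fin 3) → ℝ := fun s y =>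
    if hz : ∃ m : ℕ, ((s, y) : ℝ × EuclideanSpace ℝ (Fin 3)) ∈
        parabolicCylinder (cc m / 2) (0 : ℝ × EuclideanSpace ℝ (Fin 3))
    then πl (Nat.find hz) s y else 0 with hπ
  have hhalf : ∀ m, cc m * (1 / 2) = cc m / 2 := fun m => by ring
  have hw_ae : ∀ m, ∀ᵐ z ∂(volume.restrict (parabolicCylinder (cc m / 2)
      (0 : ℝ × EuclideanSpace ℝ (Fin 3)))), uncurry w z = uncurry (wl m) z := by
    intro m
    have hall : ∀ n, n ≤ m → ∀ᵐ z ∂(volume.restrict (parabolicCylinder (cc m / 2)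
        (0 : ℝ × EuclideanSpace ℝ (Fin 3)))),
        z ∈ parabolicCylinder (cc n / 2) (0 : ℝ × EuclideanSpace ℝ (Fin 3)) →
          uncurry (wl n) z = uncurry (wl m) z := by
      intro n hn
      have h1 := hcons_w' n m hn (1 / 2) (by norm_num)
      rw [hhalf] at h1
      rw [ae_restrict_iff' (isOpen_parabolicCylinder _ _).measurableSet] at h1 ⊢
      filter_upwards [h1] with z hz _ hzn
      exact hz hzn
    have hall' : ∀ᵐ z ∂(volume.restrict (parabolicCylinder (cc m / 2)
        (0 : ℝ × EuclideanSpace ℝ (Fin 3)))), ∀ n ∈ Finset.range (m + 1),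
        z ∈ parabolicCylinder (cc n / 2) (0 : ℝ × EuclideanSpace ℝ (Fin 3)) →
          uncurry (wl n) z = uncurry (wl m) z :=
      (Finset.range (m + 1)).eventually_all.2 fun n hn =>
        hall n (Nat.lt_succ_iff.1 (Finset.mem_range.1 hn))
    filter_upwards [hall', ae_restrict_mem (isOpen_parabolicCylinder _ _).measurableSet] with z hz hzm
    have hex : ∃ n : ℕ, z ∈ parabolicCylinder (cc n / 2) (0 : ℝ × EuclideanSpace ℝ (Fin 3)) :=
      ⟨m, hzm⟩
    have hN : Nat.find hex ≤ m := Nat.find_min' hex hzm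
    have hzN := Nat.find_spec hex
    have e : uncurry w z = uncurry (wl (Nat.find hex)) z := by
      rcases z with ⟨s, y⟩
      show (if hz : ∃ m : ℕ, ((s, y) : ℝ × EuclideanSpace ℝ (Fin 3)) ∈
          parabolicCylinder (cc m / 2) (0 : ℝ × EuclideanSpace ℝ (Fin 3))
        then wl (Nat.find hz) s y else 0) = wl (Nat.find hex) s y
      rw [dif_pos hex]
    rw [e]
    exact hz (Nat.find hex) (Finset.mem_range.2 (Nat.lt_succ_of_le hN)) hzN
  have hπ_ae : ∀ m, ∀ᵐ z ∂(volume.restrict (parabolicCylinder (cc m / 2)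
      (0 : ℝ × EuclideanSpace ℝ (Fin 3)))), uncurry π z = uncurry (πl m) z := by
    intro m
    have hall : ∀ n, n ≤ m → ∀ᵐ z ∂(volume.restrict (parabolicCylinder (cc m / 2)
        (0 : ℝ × EuclideanSpace ℝ (Fin 3)))),
        z ∈ parabolicCylinder (cc n / 2) (0 : ℝ × EuclideanSpace ℝ (Fin 3)) →
          uncurry (πl n) z = uncurry (πl m) z := by
      intro n hn
      have h1 := hcons_π' n m hn (1 / 2) (by norm_num)
      rw [hhalf] at h1
      rw [ae_restrict_iff' (isOpen_parabolicCylinder _ _).measurableSet] at h1 ⊢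
      filter_upwards [h1] with z hz _ hzn
      exact hz hzn
    have hall' : ∀ᵐ z ∂(volume.restrict (parabolicCylinder (cc m / 2)
        (0 : ℝ × EuclideanSpace ℝ (Fin 3)))), ∀ n ∈ Finset.range (m + 1),
        z ∈ parabolicCylinder (cc n / 2) (0 : ℝ × EuclideanSpace ℝ (Fin 3)) →
          uncurry (πl n) z = uncurry (πl m) z :=
      (Finset.range (m + 1)).eventually_all.2 fun n hn =>
        hall n (Nat.lt_succ_iff.1 (Finset.mem_range.1 hn))
    filter_upwards [hall', ae_restrict_mem (isOpen_parabolicCylinder _ _).measurableSet] with z hz hzm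
    have hex : ∃ n : ℕ, z ∈ parabolicCylinder (cc n / 2) (0 : ℝ × EuclideanSpace ℝ (Fin 3)) :=
      ⟨m, hzm⟩
    have hN : Nat.find hex ≤ m := Nat.find_min' hex hzm
    have hzN := Nat.find_spec hex
    have e : uncurry π z = uncurry (πl (Nat.find hex)) z := by
      rcases z with ⟨s, y⟩
      show (if hz : ∃ m : ℕ, ((s, y) : ℝ × EuclideanSpace ℝ (Fin 3)) ∈
          parabolicCylinder (cc m / 2) (0 : ℝ × EuclideanSpace ℝ (Fin 3))
        then πl (Nat.find hz) s y else 0) = πl (Nat.find hex) s y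
      rw [dif_pos hex]
    rw [e]
    exact hz (Nat.find hex) (Finset.mem_range.2 (Nat.lt_succ_of_le hN)) hzN
  -- ## the conclusion on an arbitrary cylinder `Q(a)`
  refine ⟨δ, w, π, hδ, hδge, fun a ha => ?_⟩
  obtain ⟨m, hm⟩ := pow_unbounded_of_one_lt (2 * a) (by norm_num : (1 : ℝ) < 2)
  have hm' : a < cc m / 2 := by show a < 2 ^ m / 2; linarith
  set R : ℝ := a / cc m with hRdef
  have hR : R ∈ Ioo (0 : ℝ) 1 := by
    refine ⟨div_pos ha (hcc_pos m), ?_⟩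
    rw [hRdef, div_lt_one (hcc_pos m)]
    linarith [hcc_pos m]
  have hcR : cc m * R = a := by rw [hRdef, mul_div_cancel₀ a (hcc_pos m).ne']
  have hsubQ : parabolicCylinder a (0 : ℝ × EuclideanSpace ℝ (Fin 3)) ⊆
      parabolicCylinder (cc m / 2) (0 : ℝ × EuclideanSpace ℝ (Fin 3)) :=
    parabolicCylinder_mono ha.le hm'.le _
  have hw_a : ∀ᵐ z ∂(volume.restrict (parabolicCylinder a (0 : ℝ × EuclideanSpace ℝ (Fin 3)))),
      uncurry (wl m) z = uncurry w z := by
    filter_upwards [ae_restrict_of_ae_restrict_of_subset hsubQ (hw_ae m)] with z hz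
    exact hz.symm
  have hπ_a : ∀ᵐ z ∂(volume.restrict (parabolicCylinder a (0 : ℝ × EuclideanSpace ℝ (Fin 3)))),
      uncurry (πl m) z = uncurry π z := by
    filter_upwards [ae_restrict_of_ae_restrict_of_subset hsubQ (hπ_ae m)] with z hz
    exact hz.symm
  obtain ⟨h1, -, -, -⟩ := hgood m R hR
  refine ⟨?_, ?_, ?_, ?_⟩
  · -- suitability
    have h2 := h1.zoomOut (inv_pos.2 (hcc_pos m))
    have e : R / (cc m)⁻¹ = a := by rw [div_inv_eq_mul, mul_comm, hcR]
    rw [e] at h2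
    exact h2.congr_ae' hw_a hπ_a
  · -- `w ∈ L³(Q(a))`
    have h2 := hwl_memLp m R hR
    rw [hcR] at h2
    exact h2.ae_eq hw_a
  · -- strong convergence of the velocities
    have h2 := hbase' m R hR
    rw [hcR] at h2
    refine (tendsto_congr fun j => ?_).1 h2
    refine eLpNorm_congr_ae ?_
    filter_upwards [hw_a] with z hz
    show uncurry (Uz (lam (δ j))) z - uncurry (wl m) z = uncurry (Uz (lam (δ j))) z - uncurry w z
    rw [hz]
  · -- weak convergence of the pressures
    intro g hg
    have hg' : MemLp g 3 (volume.restrict (parabolicCylinder (cc m * R)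
        (0 : ℝ × EuclideanSpace ℝ (Fin 3)))) := by rw [hcR]; exact hg
    have h2 := hweak' m R hR g hg'
    rw [hcR] at h2
    have e : ∫ w' in parabolicCylinder a (0 : ℝ × EuclideanSpace ℝ (Fin 3)), (πl m) w'.1 w'.2 * g w' =
        ∫ w' in parabolicCylinder a (0 : ℝ × EuclideanSpace ℝ (Fin 3)), π w'.1 w'.2 * g w' := by
      refine integral_congr_ae ?_
      filter_upwards [hπ_a] with z hz
      change (πl m) z.1 z.2 = π z.1 z.2 at hz
      rw [hz]
    rw [e] at h2
    exact h2

end Limit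

end Literature.Analysis.FluidPDE

end
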